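import Summits.BirchSwinnertonDyer.BirchSwinnertonDyer.Theorems.ErratumRoadFiveEulerHalfGenusFrameSupplySignOdd
import Summits.BirchSwinnertonDyer.BirchSwinnertonDyer.Theorems.ErratumRoadFiveEulerHalfRamTwistClassAtQ
import Summits.BirchSwinnertonDyer.BirchSwinnertonDyer.Theorems.AdditiveBranchIMCMultLowerFieldSupplyMClass
import Literature.NumberTheory.EllipticCurves.NonvanishingTwistsPrescribedSplittingOfHoffsteinLuoProofs
import Literature.NumberTheory.EllipticCurves.ModularityVersionApProofs
import Literature.NumberTheory.EllipticCurves.RootNumberEvenAnalyticRankProofs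
import HarnessLib

/-!
# Route `ErratumRoadFive` (K2), crux `EulerHalfNotRamNoInertSetAtFive` (stmt-BirchSwinnertonDyer-19715), crux idea
# `ramified-twin-ram-transport` — the FIELD SUPPLY of the ramified genus frame (LEAD g7 TURNKEY §8, stub S1
# `stub_supplyRC`) at EVERY ODD additive potentially multiplicative prime `q` (incl. `q = 3`), DERIVED from
# Friedberg–Hoffstein's all-split theorem (⟸ Hoffstein–Luo 1997) and Modularity

Cell `bsd-stepL`, width seat `bsd-line-er5-p1-w5` (g5). THEOREMS ONLY; no definition, no named fact, no `sorry`.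
Helper `--supports stmt-BirchSwinnertonDyer-19715`; it closes nothing by itself.

THE STATEMENT (`exists_ramifiedFrame`). `W/ℚ` globally minimal with `w(W) = −1`, `q` an ODD ADDITIVE, POTENTIALLY
MULTIPLICATIVE prime of `W` (`ord_q j < 0`; `q = 3` allowed), `S` any finite set of naturals, `B` any bound. Then there are a
fundamental discriminant `D = q*·T < 0` with `D ≡ 1 (mod 8)`, `|D| > B`, a prime `ℓ₀ ∣ T` outside `N_W` and `S`,
an imaginary quadratic field `K` with `d_K = D`, and a globally minimal `A ≅ W^{(D)}` such that: `q` is the ONLY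
prime of `N_W` ramified in `K`; every other prime of `N_W`, the prime `2`, and every odd prime of `S` other than
`q` SPLIT in `K`; the twin `A` is MULTIPLICATIVE and NON-SPLIT at `q`; and `L(A, 1) ≠ 0` (`r_an(A) = 0`) — bsd-addord's
`RamifiedKolyvaginFieldM`-supply (`ThreeFieldRoadSupply.exists_ramifiedClass_partner_mult`, crux 19359, «their `p` = our `q`»)
transposed to the rank-ONE source of the served S1b class; `exists_genusFrame` repackages it in the binders of
`RamifiedTwinGenusHeegner.exists_genusHeegnerPoint_of_ramifiedTwin` (p665860) and `RamifiedTwinRamTransport.exists_eqFrame`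
(p666673). At `5 ≤ q` (without `S`, `T`, `ℓ₀`) this is the content of `EulerHalfGenusFrame.genusFrameTwistSupply_of_hoffsteinLuo`
(p667834, -w6: imaginary auxiliary twist + Hoffstein–Luo's raw form); this file is the ODD-`q` version (`q = 3` corner).

THE RECIPE (no new Literature fact). `V = (W^{(q*)})_min` is multiplicative at `q`; `ε := W_q(V)`. A Dirichlet
prime `ℓ₀ ≡ q (mod 8)`, `ℓ₀ > N_W + max S`, with `(ℓ₀/ℓ) = (q/ℓ)` at the odd primes `ℓ ≠ q` of `N_W` and `S` and
`(ℓ₀/q) = ((−1)^{(q−1)/2}/q)·ε` (`exists_prime_jacobiSym_prescribed`); so `q*ℓ₀* = qℓ₀ ≡ 1 (mod 8)`,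
`(qℓ₀/ℓ) = (q/ℓ)² = 1`, `(ℓ₀*/q) = ε`. The REAL sign law (`rootNumber_mul_rootNumber_realRamifiedTwist_of_mult_model`)
at odd `q` (`…SupplySignOdd`: `f_q(W) = 2` by Ogg's tame formula, `Additive.condExpTwo_of_twist_pm_p`) gives
`w(W)·w(W^{(q*ℓ₀*)}) = (ℓ₀*/q)·ε = 1`, so `X = (W^{(q*ℓ₀*)})_min` has `w(X) = −1`; Friedberg–Hoffstein
(`exists_neg_fundamental_twist_ne_zero_of_friedbergHoffstein`) gives `d < 0`, `d ≡ 1 (mod 8)`, `|d| > B`, every prime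
of `2qℓ₀N_W` and of `S` split in `ℚ(√d)`, `L(X^{(d)}, 1) ≠ 0`. With `T = ℓ₀*d`, `D = q*T = qℓ₀d`, `K = ℚ(√D)`,
`A = (X^{(d)})_min ≅ W^{(D)}`: `(D/ℓ) = (qℓ₀/ℓ)(d/ℓ) = 1` off `q`, `D ≡ 1 (mod 8)`, and `A ≅ W^{(q*·T)}` is non-split
multiplicative at `q` since `(T/q) = ε` (`EulerHalfRamTwist.not_hasSplitMultiplicativeReductionAtPrime_ramTwist_iff`).

References: [cite: FriedbergHoffstein1995, Thm. B] [cite: HoffsteinLuo1997, Theorem (§1, pp. 435–436)]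
[cite: Rohrlich1993Compositio, Prop. 2(ii),(iii)] [cite: IrelandRosen1990, Ch. 16 §1]
[cite: SilvermanAEC2009, X.5 Cor. 5.4 and VII.5 Prop. 5.1]. Axioms: `propext`, `Classical.choice`, `Quot.sound`.
No summit statement is proved here; BSD is proved for no curve.
-/

set_option autoImplicit false
-- D-0017: single-problem summit, so `Summit.BirchSwinnertonDyer.BirchSwinnertonDyer.…` repeats a namespace BY DESIGN.
set_option linter.dupNamespace false

noncomputable section

open scoped Classical NumberTheorySymbols

open WeierstrassCurve NumberField IsDedekindDomain
  Literature.NumberTheory.EllipticCurves Literature.NumberTheory.EllipticCurves.ModularForms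
  Literature.NumberTheory.EllipticCurves.Rank1Residual
  Literature.NumberTheory.QuadraticFields
  Summit.BirchSwinnertonDyer.Rank1Residual Summit.BirchSwinnertonDyer.Rank1Residual.Additive
  Summit.BirchSwinnertonDyer.BirchSwinnertonDyer.Theorems.AdditiveKoly.RamifiedHabitat
  Summit.BirchSwinnertonDyer.BirchSwinnertonDyer.Theorems.ThreeFieldRoadSupply
  Summit.BirchSwinnertonDyer.BirchSwinnertonDyer.Theorems.EulerHalfRamTwist

namespace Summit.BirchSwinnertonDyer.BirchSwinnertonDyer.Theorems.EulerHalfGenusSupply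

section Supply

variable (W : WeierstrassCurve ℚ) [W.IsElliptic] [W.IsGloballyMinimal] (q : ℕ) [hq : Fact q.Prime]

/-- **The ramified genus-frame field at an ODD potentially multiplicative prime, from Friedberg–Hoffstein and
Modularity.** For `W/ℚ` globally minimal with `w(W) = −1`, an odd additive potentially multiplicative prime `q` of `W`
(`q = 3` allowed), a finite set `S` and a bound `B`:
a factorisation `d_K = q*·T` with `T ≡ 1 (4)` squarefree prime to `q`, a prime `ℓ₀ ∣ T` with `ℓ₀ ∤ 2qN_W`,
`ℓ₀ ∉ S`, an imaginary quadratic `K` with `d_K ≡ 1 (8)` squarefree and `|d_K| > B`, in which every prime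
`ℓ ≠ q` of `N_W`, the prime `2` and every odd prime `ℓ ≠ q` of `S` split and `q` is the only prime of `N_W`
that ramifies, and a globally minimal `A ≅ W^{(d_K)}` of analytic rank `0`, multiplicative and NON-SPLIT at `q`.
See the module docstring for the construction. [cite: FriedbergHoffstein1995, Thm. B]
[cite: Rohrlich1993Compositio, Prop. 2(ii),(iii)] [cite: IrelandRosen1990, Ch. 16 §1] -/
theorem exists_ramifiedFrame
    (hFH : friedbergHoffstein_exists_heegnerField_splitDivisors_twist_ne_zero)
    (hmod : exists_isNewformOf) (hL : hasEntireLFunction_rat)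
    (hq2 : q ≠ 2) (hw : W.rootNumber = -1) (hadd : Addv W q) (hpot : Additive.PotMult W q)
    (S : Finset ℕ) (B : ℕ) :
    ∃ (T : ℤ) (ℓ₀ : ℕ) (K : Type) (_ : Field K) (_ : NumberField K)
      (A : WeierstrassCurve ℚ) (_ : A.IsElliptic) (_ : A.IsGloballyMinimal),
      IsImaginaryQuadratic K ∧
      NumberField.discr K = ((-1 : ℤ) ^ (q / 2) * q) * T ∧
      NumberField.discr K % 8 = 1 ∧ Squarefree (NumberField.discr K) ∧
      B < (NumberField.discr K).natAbs ∧
      (T % 4 = 1 ∧ Squarefree T ∧ ¬ (q : ℤ) ∣ T) ∧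
      (ℓ₀.Prime ∧ ℓ₀ ≠ 2 ∧ ℓ₀ ≠ q ∧ (ℓ₀ : ℤ) ∣ T ∧ ¬ ℓ₀ ∣ W.conductorNorm ℤ ∧ ℓ₀ ∉ S) ∧
      (∀ ℓ : ℕ, ℓ.Prime → ℓ ∣ W.conductorNorm ℤ → ℓ ≠ q → SatisfiesHeegnerHypothesis ℓ K) ∧
      SatisfiesHeegnerHypothesis 2 K ∧
      (∀ ℓ ∈ S, ℓ.Prime → ℓ ≠ q → SatisfiesHeegnerHypothesis ℓ K) ∧
      (∀ ℓ : ℕ, ℓ.Prime → (ℓ : ℤ) ∣ NumberField.discr K → ℓ ∣ W.conductorNorm ℤ → ℓ = q) ∧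
      (∃ C : VariableChange ℚ, C • W.quadraticTwist (NumberField.discr K : ℚ) = A) ∧
      A.analyticRank = 0 ∧
      A.HasMultiplicativeReductionAtPrime q ∧ ¬ A.HasSplitMultiplicativeReductionAtPrime q := by
  have hq' : q.Prime := hq.out
  have hqodd : q % 2 = 1 := Nat.odd_iff.mp ((Nat.Prime.eq_two_or_odd' hq').resolve_left hq2)
  have hNW0 : W.conductorNorm ℤ ≠ 0 := (W.conductorNorm_pos_holds).ne'
  have hqN : q ∣ W.conductorNorm ℤ := (W.dvd_conductorNorm_iff_not_hasGoodReductionAtPrime q).mpr hadd.1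
  -- §a the multiplicative twist model `V ≅ W^{(q*)}` and its sign `ε = W_q(V)`
  have hqs0 : ((-1 : ℚ) ^ (q / 2) * q) ≠ 0 :=
    mul_ne_zero (pow_ne_zero _ (by norm_num)) (Nat.cast_ne_zero.mpr hq'.ne_zero)
  obtain ⟨V, iV, iVm, CV, hCV⟩ := AdditivePotMult.exists_globallyMinimal_model_twist W hqs0
  have hmultV : Mult V q :=
    AdditivePotMult.mult_of_model_twist hqs0
      ((show AdditivePotMult.PotMult W q from ⟨hadd, hpot⟩).mult_quadraticTwist_pStar hq2) ⟨CV, hCV⟩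
  set εV : ℤ := (if V.HasSplitMultiplicativeReductionAtPrime q then -1 else 1) with hεV
  have hεsq : εV * εV = 1 := by rw [hεV]; split_ifs <;> norm_num
  have hε1 : εV = 1 ∨ εV = -1 := by rw [hεV]; split_ifs <;> simp
  -- the unit `s = (−1)^{(q−1)/2}`
  set s : ℤ := (-1 : ℤ) ^ (q / 2) with hs
  have hsq : ¬ (q : ℤ) ∣ s := by
    intro h
    have h1 : q ∣ s.natAbs := by simpa using Int.natAbs_dvd_natAbs.mpr h
    rw [Int.isUnit_iff_natAbs_eq.mp ((isUnit_neg_one (α := ℤ)).pow _)] at h1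
    exact hq'.not_dvd_one h1
  have hsgcd : Int.gcd s q = 1 := by
    rcases neg_one_pow_eq_or ℤ (q / 2) with h | h <;> simp [hs, h]
  -- §b the Dirichlet prime `ℓ₀`
  set P : Finset ℕ := (insert q ((W.conductorNorm ℤ).primeFactors ∪ S)).filter (fun ℓ ↦ ℓ.Prime ∧ ℓ ≠ 2)
    with hP
  have hPmem : ∀ ℓ ∈ P, ℓ.Prime ∧ ℓ ≠ 2 := fun ℓ hℓ ↦ (Finset.mem_filter.mp hℓ).2
  set ε : ℕ → ℤ := fun ℓ ↦ if ℓ = q then J(s | q) * εV else J((q : ℤ) | ℓ) with hεdef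
  have hεP : ∀ ℓ ∈ P, ε ℓ = 1 ∨ ε ℓ = -1 := by
    intro ℓ hℓ
    obtain ⟨hℓp, -⟩ := hPmem ℓ hℓ
    by_cases hℓq : ℓ = q
    · subst hℓq
      simp only [hεdef, if_true]
      rcases jacobiSym.eq_one_or_neg_one hsgcd with h | h <;> rcases hε1 with h' | h' <;> simp [h, h']
    · simp only [hεdef, if_neg hℓq]
      refine jacobiSym.eq_one_or_neg_one ?_
      rw [Int.gcd_natCast_natCast]
      exact (Nat.coprime_primes hq' hℓp).mpr (Ne.symm hℓq)
  obtain ⟨ℓ₀, hℓ₀, hℓ₀B, hℓ₀8, hℓ₀J⟩ :=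
    exists_prime_jacobiSym_prescribed P hPmem ε hεP (q % 8) (by omega) (W.conductorNorm ℤ + S.sup id)
  have hℓ₀N : ¬ ℓ₀ ∣ W.conductorNorm ℤ := fun h ↦ by
    have := Nat.le_of_dvd W.conductorNorm_pos_holds h; omega
  have hℓ₀S : ℓ₀ ∉ S := fun h ↦ by
    have : ℓ₀ ≤ S.sup id := Finset.le_sup (f := id) h; omega
  have hℓ₀q : ℓ₀ ≠ q := fun h ↦ hℓ₀N (h ▸ hqN)
  have hℓ₀2 : ℓ₀ ≠ 2 := by rintro rfl; omega
  haveI hℓ₀F : Fact ℓ₀.Prime := ⟨hℓ₀⟩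
  have hls_eq : (-1 : ℤ) ^ (ℓ₀ / 2) = s := by
    have h : ℓ₀ / 2 % 2 = q / 2 % 2 := by omega
    rw [hs]
    conv_lhs => rw [neg_one_pow_eq_pow_mod_two, h]
    conv_rhs => rw [neg_one_pow_eq_pow_mod_two]
  -- the prescribed symbols
  have hJq : J((ℓ₀ : ℤ) | q) = J(s | q) * εV := by
    have hqP : q ∈ P := Finset.mem_filter.mpr ⟨Finset.mem_insert_self _ _, hq', hq2⟩
    have := hℓ₀J q hqP
    simpa [hεdef] using this
  have hJℓ : ∀ ℓ : ℕ, ℓ.Prime → ℓ ≠ 2 → ℓ ≠ q → (ℓ ∣ W.conductorNorm ℤ ∨ ℓ ∈ S) →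
      J((ℓ₀ : ℤ) | ℓ) = J((q : ℤ) | ℓ) := by
    intro ℓ hℓ hℓ2 hℓq hℓNS
    have hℓP : ℓ ∈ P := by
      refine Finset.mem_filter.mpr ⟨Finset.mem_insert_of_mem (Finset.mem_union.mpr ?_), hℓ, hℓ2⟩
      rcases hℓNS with h | h
      · exact Or.inl (Nat.mem_primeFactors.mpr ⟨hℓ, h, hNW0⟩)
      · exact Or.inr h
    have := hℓ₀J ℓ hℓP
    simpa [hεdef, hℓq] using this
  -- §c `q* ℓ₀* = q ℓ₀`
  set ps : ℤ := (-1 : ℤ) ^ (q / 2) * q with hps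
  set ls : ℤ := (-1 : ℤ) ^ (ℓ₀ / 2) * ℓ₀ with hls
  have hpsls : ps * ls = q * ℓ₀ := by
    rw [hps, hls, hls_eq, hs]
    rcases neg_one_pow_eq_or ℤ (q / 2) with h | h <;> rw [h] <;> ring
  have hps4 : ps % 4 = 1 := pStar_emod_four (p := q) hq2
  have hls4 : ls % 4 = 1 := pStar_emod_four (p := ℓ₀) hℓ₀2
  have hpsls8 : (ps * ls) % 8 = 1 := by
    have h8 : q * ℓ₀ % 8 = 1 := by
      rw [Nat.mul_mod, hℓ₀8, Nat.mod_mod]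
      have hlt : q % 8 < 8 := Nat.mod_lt _ (by norm_num)
      have hodd8 : q % 8 % 2 = 1 := by omega
      interval_cases (q % 8) <;> omega
    rw [hpsls]
    exact_mod_cast h8
  have hpos : 0 < ps * ls := by
    rw [hpsls]; exact mul_pos (by exact_mod_cast hq'.pos) (by exact_mod_cast hℓ₀.pos)
  have hpsls0 : ps * ls ≠ 0 := hpos.ne'
  have hJpsls : ∀ ℓ : ℕ, ℓ.Prime → ℓ ≠ 2 → ℓ ≠ q → (ℓ ∣ W.conductorNorm ℤ ∨ ℓ ∈ S) →
      J(ps * ls | ℓ) = 1 := by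
    intro ℓ hℓ hℓ2 hℓq hℓNS
    have hℓnq : ¬ (ℓ : ℤ) ∣ (q : ℤ) := fun h ↦
      hℓq ((Nat.prime_dvd_prime_iff_eq hℓ hq').mp (Int.natCast_dvd_natCast.mp h))
    rw [hpsls, jacobiSym.mul_left, hJℓ ℓ hℓ hℓ2 hℓq hℓNS, jacobiSym_mul_self_eq_one hℓ hℓnq]
  -- §d the auxiliary REAL twist `X ≅ W^{(q* ℓ₀*)}` has root number `−1`
  have hgcd : Int.gcd ls (W.conductorNorm ℤ) = 1 := by
    rw [Int.gcd_eq_natAbs, hls, natAbs_pStar]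
    simpa using (Nat.Prime.coprime_iff_not_dvd hℓ₀).mpr hℓ₀N
  have hJls : J(ls | q) = εV := by
    rw [hls, hls_eq, jacobiSym.mul_left, hJq, ← mul_assoc, jacobiSym_mul_self_eq_one hq' hsq, one_mul]
  have hsign := rootNumber_mul_rootNumber_realRamifiedTwist_of_mult_model_odd W q hmod hq2 V CV hCV hmultV
    hls4 (squarefree_pStar (p := ℓ₀)) hgcd hpos (fun ℓ hℓ hℓN hℓq hℓ2 ↦ hJpsls ℓ hℓ hℓ2 hℓq (Or.inl hℓN))
    (fun _ ↦ hpsls8)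
  rw [hw, jacobiSym.legendreSym.to_jacobiSym, hJls, hεsq] at hsign
  have hXroot' : (W.quadraticTwist (((ps * ls : ℤ)) : ℚ)).rootNumber = -1 := by linarith
  have hD₀q : (((ps * ls : ℤ)) : ℚ) ≠ 0 := by exact_mod_cast hpsls0
  obtain ⟨X, iX, iXm, CX, hCX⟩ := exists_isGloballyMinimal_smul_eq_quadraticTwist W hD₀q
  have hXroot : X.rootNumber = -1 := by rw [← X.rootNumber_smul_holds CX, hCX]; exact hXroot'
  -- §e Friedberg–Hoffstein on `X`
  obtain ⟨d, hdneg, hdsq, hd8, hdB, hdS, -, hLd⟩ := exists_neg_fundamental_twist_ne_zero_of_friedbergHoffstein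
    hFH X hXroot (insert q (insert ℓ₀ ((W.conductorNorm ℤ).primeFactors ∪ S))) B
  have hd4 : d % 4 = 1 := by omega
  have hd0 : d ≠ 0 := hdneg.ne
  have hJdq : J(d | q) = 1 := hdS q (Finset.mem_insert_self _ _) hq' hq2
  have hJdℓ₀ : J(d | ℓ₀) = 1 :=
    hdS ℓ₀ (Finset.mem_insert_of_mem (Finset.mem_insert_self _ _)) hℓ₀ hℓ₀2
  have hJdN : ∀ ℓ : ℕ, ℓ.Prime → ℓ ∣ W.conductorNorm ℤ → ℓ ≠ 2 → J(d | ℓ) = 1 := fun ℓ hℓ hℓN hℓ2 ↦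
    hdS ℓ (Finset.mem_insert_of_mem (Finset.mem_insert_of_mem (Finset.mem_union_left _
      (Nat.mem_primeFactors.mpr ⟨hℓ, hℓN, hNW0⟩)))) hℓ hℓ2
  have hJdS : ∀ ℓ ∈ S, ℓ.Prime → ℓ ≠ 2 → J(d | ℓ) = 1 := fun ℓ hℓS hℓ hℓ2 ↦
    hdS ℓ (Finset.mem_insert_of_mem (Finset.mem_insert_of_mem (Finset.mem_union_right _ hℓS))) hℓ hℓ2
  have hqd : ¬ (q : ℤ) ∣ d := not_dvd_of_jacobiSym_eq_one hq' hJdq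
  have hℓ₀d : ¬ (ℓ₀ : ℤ) ∣ d := not_dvd_of_jacobiSym_eq_one hℓ₀ hJdℓ₀
  -- §f `T = ℓ₀* d`, `D = q* T = q ℓ₀ d`
  have hT4 : (ls * d) % 4 = 1 := by rw [Int.mul_emod, hls4, hd4]; decide
  have hTsq : Squarefree (ls * d) := by
    rw [squarefree_mul_iff]
    refine ⟨?_, squarefree_pStar, hdsq⟩
    refine (Int.isCoprime_iff_gcd_eq_one.mpr ?_).isRelPrime
    rw [Int.gcd_eq_natAbs, hls, natAbs_pStar]
    exact (Nat.Prime.coprime_iff_not_dvd hℓ₀).mpr fun h ↦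
      hℓ₀d (Int.natAbs_dvd_natAbs.mp (by simpa using h))
  have hqT : ¬ (q : ℤ) ∣ ls * d := by
    intro h
    rcases Int.Prime.dvd_mul' hq' h with h | h
    · exact hℓ₀q (eq_of_prime_dvd_pStar (p := ℓ₀) hq' h).symm
    · exact hqd h
  have hD8 : (ps * (ls * d)) % 8 = 1 := by rw [← mul_assoc, Int.mul_emod, hpsls8, hd8]; decide
  have hD4 : (ps * (ls * d)) % 4 = 1 := by omega
  have hDneg : ps * (ls * d) < 0 := by rw [← mul_assoc]; exact mul_neg_of_pos_of_neg hpos hdneg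
  have hD1 : ps * (ls * d) ≠ 1 := (hDneg.trans one_pos).ne
  have hDsq : Squarefree (ps * (ls * d)) := by
    rw [squarefree_mul_iff]
    refine ⟨?_, squarefree_pStar, hTsq⟩
    refine (Int.isCoprime_iff_gcd_eq_one.mpr ?_).isRelPrime
    rw [Int.gcd_eq_natAbs, hps, natAbs_pStar]
    exact (Nat.Prime.coprime_iff_not_dvd hq').mpr fun h ↦
      hqT (Int.natAbs_dvd_natAbs.mp (by simpa using h))
  have hDB : B < (ps * (ls * d)).natAbs := by
    rw [← mul_assoc, Int.natAbs_mul]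
    exact hdB.trans_le (Nat.le_mul_of_pos_left _ (Int.natAbs_pos.mpr hpsls0))
  -- §g the field `K = ℚ(√D)`
  obtain ⟨K, iF, iN, h2K, hdisc⟩ :=
    Quadratic.exists_numberField_discr_eq (D := ps * (ls * d)) (Or.inl ⟨hD4, hDsq, hD1⟩)
  have hK : IsImaginaryQuadratic K := isImaginaryQuadratic_of_discr_eq_of_neg h2K hdisc hDneg
  have hSHH : ∀ ℓ : ℕ, ℓ.Prime → (ℓ ≠ 2 → J(ps * (ls * d) | ℓ) = 1) → SatisfiesHeegnerHypothesis ℓ K := by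
    intro ℓ hℓ hJ
    refine (satisfiesHeegnerHypothesis_iff_kronecker ℓ K h2K).mpr fun r hr hrℓ ↦ ?_
    obtain rfl : r = ℓ := (Nat.prime_dvd_prime_iff_eq hr hℓ).mp hrℓ
    rw [hdisc]
    exact ⟨fun _ ↦ hD8, hJ⟩
  have hJD : ∀ ℓ : ℕ, ℓ.Prime → ℓ ≠ 2 → ℓ ≠ q → (ℓ ∣ W.conductorNorm ℤ ∨ ℓ ∈ S) →
      J(ps * (ls * d) | ℓ) = 1 := by
    intro ℓ hℓ hℓ2 hℓq hℓNS
    have hJd : J(d | ℓ) = 1 := by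
      rcases hℓNS with h | h
      · exact hJdN ℓ hℓ h hℓ2
      · exact hJdS ℓ h hℓ hℓ2
    rw [← mul_assoc, jacobiSym.mul_left, hJpsls ℓ hℓ hℓ2 hℓq hℓNS, hJd, mul_one]
  have hsplit : ∀ ℓ : ℕ, ℓ.Prime → ℓ ∣ W.conductorNorm ℤ → ℓ ≠ q → SatisfiesHeegnerHypothesis ℓ K :=
    fun ℓ hℓ hℓN hℓq ↦ hSHH ℓ hℓ fun hℓ2 ↦ hJD ℓ hℓ hℓ2 hℓq (Or.inl hℓN)
  have h2 : SatisfiesHeegnerHypothesis 2 K := hSHH 2 Nat.prime_two fun h ↦ (h rfl).elim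
  have hS : ∀ ℓ ∈ S, ℓ.Prime → ℓ ≠ q → SatisfiesHeegnerHypothesis ℓ K :=
    fun ℓ hℓS hℓ hℓq ↦ hSHH ℓ hℓ fun hℓ2 ↦ hJD ℓ hℓ hℓ2 hℓq (Or.inr hℓS)
  have hram : ∀ ℓ : ℕ, ℓ.Prime → (ℓ : ℤ) ∣ NumberField.discr K → ℓ ∣ W.conductorNorm ℤ → ℓ = q := by
    intro ℓ hℓ hℓD hℓN
    rw [hdisc] at hℓD
    rcases Int.Prime.dvd_mul' hℓ hℓD with h | h
    · exact eq_of_prime_dvd_pStar (p := q) hℓ h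
    · rcases Int.Prime.dvd_mul' hℓ h with h | h
      · exact (hℓ₀N ((eq_of_prime_dvd_pStar (p := ℓ₀) hℓ h) ▸ hℓN)).elim
      · exfalso
        by_cases hℓ2 : ℓ = 2
        · subst hℓ2
          have h2d : (2 : ℤ) ∣ d := by exact_mod_cast h
          omega
        · exact not_dvd_of_jacobiSym_eq_one hℓ (hJdN ℓ hℓ hℓN hℓ2) h
  -- §h the twin `A = (X^{(d)})_min ≅ W^{(D)}`, of analytic rank `0`
  have hdq0 : (d : ℚ) ≠ 0 := by exact_mod_cast hd0
  haveI := X.isElliptic_quadraticTwist hdq0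
  obtain ⟨A, iA, iAm, CA, hCA⟩ := exists_isGloballyMinimal_smul_eq_quadraticTwist X hdq0
  have hrA : A.analyticRank = 0 := by
    rw [← analyticRank_smul A CA, hCA]
    exact ((X.quadraticTwist (d : ℚ)).analyticRank_eq_zero_iff_holds (hL _)).2 hLd
  have hparam : (((ps * ls : ℤ)) : ℚ) * (d : ℚ) = (((ps * (ls * d) : ℤ)) : ℚ) := by push_cast; ring
  have hAW : ∃ C : VariableChange ℚ, C • W.quadraticTwist (((ps * (ls * d) : ℤ)) : ℚ) = A := by
    obtain ⟨C₃, hC₃⟩ : ∃ C₃ : VariableChange ℚ, C₃ = ⟨CX.u, (d : ℚ) * CX.r, 0, 0⟩ := ⟨_, rfl⟩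
    have e1 : W.quadraticTwist (((ps * (ls * d) : ℤ)) : ℚ) = (C₃ * CA) • A := by
      rw [← hparam, ← quadraticTwist_quadraticTwist, ← hCX, WeierstrassCurve.quadraticTwist_smul, ← hC₃,
        mul_smul, hCA]
    exact ⟨(C₃ * CA)⁻¹, by rw [e1, inv_smul_smul]⟩
  -- §i the twin is multiplicative and NON-SPLIT at `q`: `(T/q) = (ℓ₀*/q)(d/q) = ε`
  obtain ⟨Cd, hCd⟩ := hAW
  have hparam' : (((ps * (ls * d) : ℤ)) : ℚ) = ((-1 : ℚ) ^ (q / 2) * q) * ((ls * d : ℤ) : ℚ) := by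
    rw [hps]; push_cast; ring
  have hCd' : Cd • W.quadraticTwist (((-1 : ℚ) ^ (q / 2) * q) * ((ls * d : ℤ) : ℚ)) = A := by
    rw [← hparam']; exact hCd
  have hTz : ((ls * d : ℤ) : ZMod q) ≠ 0 := by
    rw [ne_eq, ZMod.intCast_zmod_eq_zero_iff_dvd]; exact hqT
  have hleg : legendreSym q (ls * d) = εV := by
    rw [legendreSym.mul, jacobiSym.legendreSym.to_jacobiSym, jacobiSym.legendreSym.to_jacobiSym, hJls, hJdq,
      mul_one]
  have hns : ¬ (IsSquare ((ls * d : ℤ) : ZMod q) ↔ V.HasSplitMultiplicativeReductionAtPrime q) := by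
    rw [← legendreSym.eq_one_iff q hTz, hleg, hεV]
    by_cases hsV : V.HasSplitMultiplicativeReductionAtPrime q <;> simp [hsV]
  obtain ⟨hmA, hnsA⟩ :=
    (not_hasSplitMultiplicativeReductionAtPrime_ramTwist_iff hq2 hadd hpot V CV hCV hqT Cd hCd').mpr hns
  -- §j assembly
  refine ⟨ls * d, ℓ₀, K, iF, iN, A, iA, iAm, hK, hdisc, by rw [hdisc]; exact hD8, by rw [hdisc]; exact hDsq,
    by rw [hdisc]; exact hDB, ⟨hT4, hTsq, hqT⟩,
    ⟨hℓ₀, hℓ₀2, hℓ₀q, Dvd.dvd.mul_right (Dvd.intro_left _ rfl) d, hℓ₀N, hℓ₀S⟩,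
    hsplit, h2, hS, hram, ⟨Cd, by rw [hdisc]; exact hCd⟩, hrA, hmA, hnsA⟩

/-- **The genus frame in its consumers' binders.** For `W/ℚ` globally minimal of analytic rank `1` with an ODD
additive potentially multiplicative prime `q`, a finite set `S` and a bound `B`: an imaginary quadratic `K` with
`d_K ≡ 1 (8)`, `|d_K| > B`, `q ∣ d_K`, and a globally minimal rank-zero twin `A ≅ W^{(d_K)}` such that — in the
binders of `RamifiedTwinGenusHeegner.exists_genusHeegnerPoint_of_ramifiedTwin` (p665860) and of
`RamifiedTwinRamTransport.exists_eqFrame` / `padicValNat_tamagawaProduct_ramTwin_eq` (p666673, p665568) — every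
prime of `N_W` not dividing `d_K` splits in `K` (equivalently: every prime `ℓ ≠ q` of `N_W` splits), `A` is
multiplicative NON-SPLIT at every prime of `(N_W, d_K)` (i.e. at `q`), `d_K` has a free ramified prime
`ℓ₀ ∤ N_W`, and the odd primes `≠ q` of `S` split. From `exists_ramifiedFrame` (`w(W) = −1` by
`rootNumber_eq_neg_one_pow_analyticRank_of_exists_isNewformOf`). [cite: FriedbergHoffstein1995, Thm. B]
[cite: Rohrlich1993Compositio, Prop. 2(ii),(iii)] -/
theorem exists_genusFrame
    (hFH : friedbergHoffstein_exists_heegnerField_splitDivisors_twist_ne_zero)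
    (hmod : exists_isNewformOf) (hL : hasEntireLFunction_rat)
    (hq2 : q ≠ 2) (hr : W.analyticRank = 1) (hadd : Addv W q) (hpot : Additive.PotMult W q)
    (S : Finset ℕ) (B : ℕ) :
    ∃ (K : Type) (_ : Field K) (_ : NumberField K)
      (A : WeierstrassCurve ℚ) (_ : A.IsElliptic) (_ : A.IsGloballyMinimal),
      IsImaginaryQuadratic K ∧ NumberField.discr K % 8 = 1 ∧ B < (NumberField.discr K).natAbs ∧
      (q : ℤ) ∣ NumberField.discr K ∧
      (∀ ℓ : ℕ, ℓ.Prime → ℓ ∣ W.conductorNorm ℤ → ¬ (ℓ : ℤ) ∣ NumberField.discr K →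
        SatisfiesHeegnerHypothesis ℓ K) ∧
      (∀ ℓ : ℕ, ℓ.Prime → ℓ ∣ W.conductorNorm ℤ → ℓ ≠ q →
        ((Ideal.span {(ℓ : ℤ)}).primesOver (𝓞 K)).ncard = 2) ∧
      (∀ ℓ : ℕ, (hℓ : ℓ.Prime) → ℓ ∣ W.conductorNorm ℤ → (ℓ : ℤ) ∣ NumberField.discr K →
        (haveI : Fact ℓ.Prime := ⟨hℓ⟩;
          A.HasMultiplicativeReductionAtPrime ℓ ∧ ¬ A.HasSplitMultiplicativeReductionAtPrime ℓ)) ∧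
      (∃ ℓ : ℕ, ℓ.Prime ∧ (ℓ : ℤ) ∣ NumberField.discr K ∧ ℓ ≠ q ∧ ¬ ℓ ∣ W.conductorNorm ℤ) ∧
      (∀ ℓ ∈ S, ℓ.Prime → ℓ ≠ q → SatisfiesHeegnerHypothesis ℓ K) ∧
      (∃ C : VariableChange ℚ, C • W.quadraticTwist (NumberField.discr K : ℚ) = A) ∧
      A.analyticRank = 0 ∧
      A.HasMultiplicativeReductionAtPrime q ∧ ¬ A.HasSplitMultiplicativeReductionAtPrime q := by
  have hw : W.rootNumber = -1 := by
    rw [WeierstrassCurve.rootNumber_eq_neg_one_pow_analyticRank_of_exists_isNewformOf hmod W, hr]; norm_num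
  obtain ⟨T, ℓ₀, K, iF, iN, A, iA, iAm, hK, hD, hD8, -, hDB, -, ⟨hℓ₀, -, hℓ₀q, hℓ₀T, hℓ₀N, -⟩,
    hsplit, -, hS, hram, hAW, hrA, hmA, hnsA⟩ := exists_ramifiedFrame W q hFH hmod hL hq2 hw hadd hpot S B
  have hqD : (q : ℤ) ∣ NumberField.discr K := by
    rw [hD]; exact Dvd.dvd.mul_right (Dvd.intro_left _ rfl) T
  refine ⟨K, iF, iN, A, iA, iAm, hK, hD8, hDB, hqD, fun ℓ hℓ hℓN hℓD ↦ hsplit ℓ hℓ hℓN ?_,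
    fun ℓ hℓ hℓN hℓq ↦ hsplit ℓ hℓ hℓN hℓq ℓ hℓ dvd_rfl, fun ℓ hℓ hℓN hℓD ↦ ?_,
    ⟨ℓ₀, hℓ₀, by rw [hD]; exact Dvd.dvd.mul_left hℓ₀T _, hℓ₀q, hℓ₀N⟩, hS, hAW, hrA, hmA, hnsA⟩
  · rintro rfl; exact hℓD hqD
  · obtain rfl := hram ℓ hℓ hℓD hℓN
    exact ⟨hmA, hnsA⟩

/-- **The same, keyed to the route's published inputs**: the genus frame from Hoffstein–Luo 1997 and the
Modularity Theorem (`hHL`, `hmod`, `hL` are conjuncts of `ErratumRoadFive.PublishedInputsFive`), Friedberg–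
Hoffstein's all-split form being `friedbergHoffstein_exists_heegnerField_splitDivisors_twist_ne_zero_of_hoffsteinLuo`.
[cite: HoffsteinLuo1997, Theorem (§1, pp. 435–436)] [cite: FriedbergHoffstein1995, Thm. B] -/
theorem exists_genusFrame_of_hoffsteinLuo
    (hmod : exists_isNewformOf) (hHL : HoffsteinLuo1997_exists_twist_L_one_ne_zero)
    (hL : hasEntireLFunction_rat)
    (hq2 : q ≠ 2) (hr : W.analyticRank = 1) (hadd : Addv W q) (hpot : Additive.PotMult W q)
    (S : Finset ℕ) (B : ℕ) :
    ∃ (K : Type) (_ : Field K) (_ : NumberField K)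
      (A : WeierstrassCurve ℚ) (_ : A.IsElliptic) (_ : A.IsGloballyMinimal),
      IsImaginaryQuadratic K ∧ NumberField.discr K % 8 = 1 ∧ B < (NumberField.discr K).natAbs ∧
      (q : ℤ) ∣ NumberField.discr K ∧
      (∀ ℓ : ℕ, ℓ.Prime → ℓ ∣ W.conductorNorm ℤ → ¬ (ℓ : ℤ) ∣ NumberField.discr K →
        SatisfiesHeegnerHypothesis ℓ K) ∧
      (∀ ℓ : ℕ, ℓ.Prime → ℓ ∣ W.conductorNorm ℤ → ℓ ≠ q →
        ((Ideal.span {(ℓ : ℤ)}).primesOver (𝓞 K)).ncard = 2) ∧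
      (∀ ℓ : ℕ, (hℓ : ℓ.Prime) → ℓ ∣ W.conductorNorm ℤ → (ℓ : ℤ) ∣ NumberField.discr K →
        (haveI : Fact ℓ.Prime := ⟨hℓ⟩;
          A.HasMultiplicativeReductionAtPrime ℓ ∧ ¬ A.HasSplitMultiplicativeReductionAtPrime ℓ)) ∧
      (∃ ℓ : ℕ, ℓ.Prime ∧ (ℓ : ℤ) ∣ NumberField.discr K ∧ ℓ ≠ q ∧ ¬ ℓ ∣ W.conductorNorm ℤ) ∧
      (∀ ℓ ∈ S, ℓ.Prime → ℓ ≠ q → SatisfiesHeegnerHypothesis ℓ K) ∧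
      (∃ C : VariableChange ℚ, C • W.quadraticTwist (NumberField.discr K : ℚ) = A) ∧
      A.analyticRank = 0 ∧
      A.HasMultiplicativeReductionAtPrime q ∧ ¬ A.HasSplitMultiplicativeReductionAtPrime q :=
  exists_genusFrame W q (friedbergHoffstein_exists_heegnerField_splitDivisors_twist_ne_zero_of_hoffsteinLuo
    hmod hHL) hmod hL hq2 hr hadd hpot S B

end Supply

end Summit.BirchSwinnertonDyer.BirchSwinnertonDyer.Theorems.EulerHalfGenusSupply

end
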